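import Summits.ValiantsHypothesis.ValiantsHypothesis.Theorems.LacunarySymmetroidMatrixDescartesDoorA26WallBubblingConfluentLimit

/-!
# Wall bubbling for `DoorA26` — THREE WEYL PAIRS: the three-dslope FRAME IDENTITY and the three-pair confluent determinant as a quadratic form

LINE / STUBS.  Crux `Theses.LacunarySymmetroid.DoorA26` (stmt-ValiantsHypothesis-19979; OPEN, typed, never asserted), line
`Cruxes/DoorA26/Lines/wall_bubbling.lean` (val-idea-15), obligation (W) `Stmt.stub_weylFaces`; statement file
`Cruxes/DoorA26/Lines/wall_bubbling_ConfluentDoor.lean` rev 4, stratum `Stmt.weylFaces_deepVal` with THREE Weyl pairs.  Seat val-sym-door-p2 g13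
(W1 #31); the three-pair companion of W1 #25 `…DoublyConfluentFrame`.

POSITIONS.  Pair A at `0, 5` (`δ₅ → δ₀`), pair B at `1, 4` (`δ₄ → δ₁`), pair C at `2, 3` (`δ₃ → δ₂`).  W2's one-pair frame calculus with THREE divided
differences (def-free):

* `frame_sum₃`, `frame_det₃` — `Σ_l e^{δ_l t}U_l = Σ_l c_l(t)•V_l` and `det(Σ_l e^{δ_l t}U_l) = Σ_pq polar(V_p,V_q)·c_p(t)c_q(t)` EXACTLY, with the frame
  `V = (U₀+U₅, U₁+U₄, U₂+U₃, (δ₃−δ₂)·U₃, (δ₄−δ₁)·U₄, (δ₅−δ₀)·U₅)` and coefficient functions `c_l = e^{δ_l t}` (`l ≤ 2`),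
  `c₃ = dslope (y ↦ e^{yt}) δ₂ δ₃`, `c₄ = dslope … δ₁ δ₄`, `c₅ = dslope … δ₀ δ₅`; `frame_isSymm₃`;
* `threePairDet_eq_quadForm` — at the limit coefficient functions the same quadratic form IS the three-pair confluent determinant
  `det(e^{δ₀t}(W₀ + tW₅) + e^{δ₁t}(W₁ + tW₄) + e^{δ₂t}(W₂ + tW₃))` whose zeros W1 #30 `…ThreePairCount` counts (`≤ 17` with multiplicity);
  `contDiff_threePairDet`.

Nothing in this file bears on (W)/(M)/(R) themselves, on `DoorA26`, on `MatrixDescartes` (stmt-ValiantsHypothesis-18050) or on `VP ≠ VNP`;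
registers unchanged.  `--supports stmt-ValiantsHypothesis-19979 --as helper`.  [folklore] Newton form.  [this work] the three-pair frame bookkeeping.
-/

-- `Summit.ValiantsHypothesis.ValiantsHypothesis.…` repeats a component by the D-0017 layout
-- (single-conjunct summit), which the `dupNamespace` linter flags; the name is mandated.
set_option linter.dupNamespace false

namespace Summit.ValiantsHypothesis.ValiantsHypothesis.Theorems.LacunarySymmetroidMatrixDescartes.WallBubbling

open Finset Filter Topology Polynomial
open Bubbling (polar polar_comm polar_self det_sum_smul_fin_two)
open scoped BigOperators

/-! ## 1. The three-dslope frame identity -/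

/-- **THE THREE-DSLOPE FRAME IDENTITY (letters).** [this work] -/
theorem frame_sum₃ (δ : Fin 6 → ℝ) (U : Fin 6 → Matrix (Fin 2) (Fin 2) ℝ) (t : ℝ) :
    ∑ l, Real.exp (δ l * t) • U l
      = ∑ l, (if l = 5 then dslope (fun y : ℝ => Real.exp (y * t)) (δ 0) (δ 5)
              else if l = 4 then dslope (fun y : ℝ => Real.exp (y * t)) (δ 1) (δ 4)
              else if l = 3 then dslope (fun y : ℝ => Real.exp (y * t)) (δ 2) (δ 3) else Real.exp (δ l * t)) •
          (if l = 0 then U 0 + U 5 else if l = 1 then U 1 + U 4 else if l = 2 then U 2 + U 3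
            else if l = 3 then (δ 3 - δ 2) • U 3 else if l = 4 then (δ 4 - δ 1) • U 4 else (δ 5 - δ 0) • U 5) := by
  simp only [Fin.sum_univ_six]
  have h05 : ((0 : Fin 6) = 5) = False := by decide
  have h04 : ((0 : Fin 6) = 4) = False := by decide
  have h03 : ((0 : Fin 6) = 3) = False := by decide
  have h15 : ((1 : Fin 6) = 5) = False := by decide
  have h14 : ((1 : Fin 6) = 4) = False := by decide
  have h13 : ((1 : Fin 6) = 3) = False := by decide
  have h10 : ((1 : Fin 6) = 0) = False := by decide
  have h25 : ((2 : Fin 6) = 5) = False := by decide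
  have h24 : ((2 : Fin 6) = 4) = False := by decide
  have h23 : ((2 : Fin 6) = 3) = False := by decide
  have h20 : ((2 : Fin 6) = 0) = False := by decide
  have h21 : ((2 : Fin 6) = 1) = False := by decide
  have h35 : ((3 : Fin 6) = 5) = False := by decide
  have h34 : ((3 : Fin 6) = 4) = False := by decide
  have h30 : ((3 : Fin 6) = 0) = False := by decide
  have h31 : ((3 : Fin 6) = 1) = False := by decide
  have h32 : ((3 : Fin 6) = 2) = False := by decide
  have h45 : ((4 : Fin 6) = 5) = False := by decide
  have h40 : ((4 : Fin 6) = 0) = False := by decide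
  have h41 : ((4 : Fin 6) = 1) = False := by decide
  have h42 : ((4 : Fin 6) = 2) = False := by decide
  have h43 : ((4 : Fin 6) = 3) = False := by decide
  have h50 : ((5 : Fin 6) = 0) = False := by decide
  have h51 : ((5 : Fin 6) = 1) = False := by decide
  have h52 : ((5 : Fin 6) = 2) = False := by decide
  have h53 : ((5 : Fin 6) = 3) = False := by decide
  have h54 : ((5 : Fin 6) = 4) = False := by decide
  simp only [h05, h04, h03, h15, h14, h13, h10, h25, h24, h23, h20, h21, h35, h34, h30, h31, h32, h45, h40, h41, h42, h43,
    h50, h51, h52, h53, h54, if_true, if_false]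
  rw [smul_smul, smul_smul, smul_smul, mul_comm (dslope _ _ _) (δ 3 - δ 2), mul_comm (dslope _ _ _) (δ 4 - δ 1),
    mul_comm (dslope _ _ _) (δ 5 - δ 0), sub_mul_dslope_exp, sub_mul_dslope_exp, sub_mul_dslope_exp, sub_smul, sub_smul, sub_smul,
    smul_add, smul_add, smul_add]
  abel

/-- **THE THREE-DSLOPE FRAME IDENTITY (determinant).** [this work] -/
theorem frame_det₃ (δ : Fin 6 → ℝ) (U : Fin 6 → Matrix (Fin 2) (Fin 2) ℝ) (t : ℝ) :
    (∑ l, Real.exp (δ l * t) • U l).det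
      = ∑ p, ∑ q, polar
            (if p = 0 then U 0 + U 5 else if p = 1 then U 1 + U 4 else if p = 2 then U 2 + U 3
              else if p = 3 then (δ 3 - δ 2) • U 3 else if p = 4 then (δ 4 - δ 1) • U 4 else (δ 5 - δ 0) • U 5)
            (if q = 0 then U 0 + U 5 else if q = 1 then U 1 + U 4 else if q = 2 then U 2 + U 3
              else if q = 3 then (δ 3 - δ 2) • U 3 else if q = 4 then (δ 4 - δ 1) • U 4 else (δ 5 - δ 0) • U 5) *
          ((if p = 5 then dslope (fun y : ℝ => Real.exp (y * t)) (δ 0) (δ 5)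
              else if p = 4 then dslope (fun y : ℝ => Real.exp (y * t)) (δ 1) (δ 4)
              else if p = 3 then dslope (fun y : ℝ => Real.exp (y * t)) (δ 2) (δ 3) else Real.exp (δ p * t)) *
            (if q = 5 then dslope (fun y : ℝ => Real.exp (y * t)) (δ 0) (δ 5)
              else if q = 4 then dslope (fun y : ℝ => Real.exp (y * t)) (δ 1) (δ 4)
              else if q = 3 then dslope (fun y : ℝ => Real.exp (y * t)) (δ 2) (δ 3) else Real.exp (δ q * t))) := by
  rw [frame_sum₃, det_sum_smul_fin_two]
  refine Finset.sum_congr rfl fun p _ => Finset.sum_congr rfl fun q _ => ?_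
  ring

/-- The three-pair frame of symmetric letters is symmetric. [folklore] -/
theorem frame_isSymm₃ (δ : Fin 6 → ℝ) (U : Fin 6 → Matrix (Fin 2) (Fin 2) ℝ) (hU : ∀ l, (U l).IsSymm) (l : Fin 6) :
    (if l = 0 then U 0 + U 5 else if l = 1 then U 1 + U 4 else if l = 2 then U 2 + U 3
      else if l = 3 then (δ 3 - δ 2) • U 3 else if l = 4 then (δ 4 - δ 1) • U 4 else (δ 5 - δ 0) • U 5).IsSymm := by
  split_ifs
  · exact (hU 0).add (hU 5)
  · exact (hU 1).add (hU 4)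
  · exact (hU 2).add (hU 3)
  · exact (hU 3).smul _
  · exact (hU 4).smul _
  · exact (hU 5).smul _

/-! ## 2. The three-pair confluent determinant as the same quadratic form -/

/-- **The three-pair confluent determinant as the quadratic form at the limit coefficient functions.** [this work] -/
theorem threePairDet_eq_quadForm (δ0 : Fin 6 → ℝ) (W : Fin 6 → Matrix (Fin 2) (Fin 2) ℝ) (t : ℝ) :
    ((Real.exp (δ0 0 * t)) • (W 0 + t • W 5) + (Real.exp (δ0 1 * t)) • (W 1 + t • W 4) + (Real.exp (δ0 2 * t)) • (W 2 + t • W 3)).det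
      = ∑ p, ∑ q, polar (W p) (W q) *
          ((if p = 5 then dslope (fun y : ℝ => Real.exp (y * t)) (δ0 0) (δ0 0)
              else if p = 4 then dslope (fun y : ℝ => Real.exp (y * t)) (δ0 1) (δ0 1)
              else if p = 3 then dslope (fun y : ℝ => Real.exp (y * t)) (δ0 2) (δ0 2) else Real.exp (δ0 p * t)) *
            (if q = 5 then dslope (fun y : ℝ => Real.exp (y * t)) (δ0 0) (δ0 0)
              else if q = 4 then dslope (fun y : ℝ => Real.exp (y * t)) (δ0 1) (δ0 1)
              else if q = 3 then dslope (fun y : ℝ => Real.exp (y * t)) (δ0 2) (δ0 2) else Real.exp (δ0 q * t))) := by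
  have hsum : (Real.exp (δ0 0 * t)) • (W 0 + t • W 5) + (Real.exp (δ0 1 * t)) • (W 1 + t • W 4) + (Real.exp (δ0 2 * t)) • (W 2 + t • W 3)
      = ∑ l, (if l = 5 then dslope (fun y : ℝ => Real.exp (y * t)) (δ0 0) (δ0 0)
              else if l = 4 then dslope (fun y : ℝ => Real.exp (y * t)) (δ0 1) (δ0 1)
              else if l = 3 then dslope (fun y : ℝ => Real.exp (y * t)) (δ0 2) (δ0 2) else Real.exp (δ0 l * t)) • W l := by
    simp only [Fin.sum_univ_six]
    have h05 : ((0 : Fin 6) = 5) = False := by decide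
    have h04 : ((0 : Fin 6) = 4) = False := by decide
    have h03 : ((0 : Fin 6) = 3) = False := by decide
    have h15 : ((1 : Fin 6) = 5) = False := by decide
    have h14 : ((1 : Fin 6) = 4) = False := by decide
    have h13 : ((1 : Fin 6) = 3) = False := by decide
    have h25 : ((2 : Fin 6) = 5) = False := by decide
    have h24 : ((2 : Fin 6) = 4) = False := by decide
    have h23 : ((2 : Fin 6) = 3) = False := by decide
    have h35 : ((3 : Fin 6) = 5) = False := by decide
    have h34 : ((3 : Fin 6) = 4) = False := by decide
    have h45 : ((4 : Fin 6) = 5) = False := by decide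
    simp only [h05, h04, h03, h15, h14, h13, h25, h24, h23, h35, h34, h45, if_true, if_false, dslope_exp_same, smul_add, smul_smul]
    rw [mul_comm (Real.exp (δ0 0 * t)) t, mul_comm (Real.exp (δ0 1 * t)) t, mul_comm (Real.exp (δ0 2 * t)) t]
    abel
  rw [hsum, det_sum_smul_fin_two]
  refine Finset.sum_congr rfl fun p _ => Finset.sum_congr rfl fun q _ => ?_
  ring

/-- The three-pair confluent determinant is smooth in `t`. [folklore] -/
theorem contDiff_threePairDet (n : ℕ) (δ0 : Fin 6 → ℝ) (W : Fin 6 → Matrix (Fin 2) (Fin 2) ℝ) :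
    ContDiff ℝ n (fun t : ℝ => ((Real.exp (δ0 0 * t)) • (W 0 + t • W 5) + (Real.exp (δ0 1 * t)) • (W 1 + t • W 4)
        + (Real.exp (δ0 2 * t)) • (W 2 + t • W 3)).det) := by
  have h : (fun t : ℝ => ((Real.exp (δ0 0 * t)) • (W 0 + t • W 5) + (Real.exp (δ0 1 * t)) • (W 1 + t • W 4)
        + (Real.exp (δ0 2 * t)) • (W 2 + t • W 3)).det)
      = fun t => ∑ p, ∑ q, polar (W p) (W q) *
          ((if p = 5 then dslope (fun y : ℝ => Real.exp (y * t)) (δ0 0) (δ0 0)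
              else if p = 4 then dslope (fun y : ℝ => Real.exp (y * t)) (δ0 1) (δ0 1)
              else if p = 3 then dslope (fun y : ℝ => Real.exp (y * t)) (δ0 2) (δ0 2) else Real.exp (δ0 p * t)) *
            (if q = 5 then dslope (fun y : ℝ => Real.exp (y * t)) (δ0 0) (δ0 0)
              else if q = 4 then dslope (fun y : ℝ => Real.exp (y * t)) (δ0 1) (δ0 1)
              else if q = 3 then dslope (fun y : ℝ => Real.exp (y * t)) (δ0 2) (δ0 2) else Real.exp (δ0 q * t))) := by
    funext t; exact threePairDet_eq_quadForm δ0 W t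
  rw [h]
  have hc : ∀ p : Fin 6, ContDiff ℝ n (fun t : ℝ => (if p = 5 then dslope (fun y : ℝ => Real.exp (y * t)) (δ0 0) (δ0 0)
      else if p = 4 then dslope (fun y : ℝ => Real.exp (y * t)) (δ0 1) (δ0 1)
      else if p = 3 then dslope (fun y : ℝ => Real.exp (y * t)) (δ0 2) (δ0 2) else Real.exp (δ0 p * t))) := by
    intro p
    by_cases hp5 : p = 5
    · simp only [hp5, if_true]; exact contDiff_dslope_exp _ _ n
    · by_cases hp4 : p = 4
      · subst hp4
        simp only [hp5, if_false, if_true]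
        exact contDiff_dslope_exp _ _ n
      · by_cases hp3 : p = 3
        · subst hp3
          simp only [hp5, hp4, if_false, if_true]
          exact contDiff_dslope_exp _ _ n
        · simp only [hp5, hp4, hp3, if_false]; exact contDiff_exp_const_mul' _ n
  refine ContDiff.sum fun p _ => ContDiff.sum fun q _ => ?_
  exact contDiff_const.mul ((hc p).mul (hc q))

end Summit.ValiantsHypothesis.ValiantsHypothesis.Theorems.LacunarySymmetroidMatrixDescartes.WallBubbling
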